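import Mathlib
import Summits.AtomisticToContinuum.Crystallization.Theses.GappedShellCensus
import Summits.AtomisticToContinuum.Crystallization.Theorems.CleanLimitsHaveWindows.Negative.RulerStackingClusters
import Summits.AtomisticToContinuum.Crystallization.Theorems.CleanLimitsHaveWindows.Negative.WindowLemmas

/-!
# `CleanLimitsHaveWindows` (stmt-AtomisticToContinuum-15932), negative side IV:
# the window argument — the crux is FALSE without `IsGroundState`

Route `GappedShellCensus`, crux `CleanLimitsHaveWindows` (rank 5): "clean local limits of LJ ground
states have periodic windows".  Load-bearing analysis by the standing disprover
(refuter-cdisprove-stmt-AtomisticToContinuum-15932-0), file 4/4: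

* `no_windows` — the window argument: clusters of the unit ideal stacking of a Hägg word without
  long periodic stretches admit NO periodic windows at every scale;
* `not_cleanLimitsHaveWindows_without_isGroundState` — the crux with H1
  `∀ N, IsGroundState lennardJones (x N)` weakened to injectivity, everything else verbatim
  (statement inline; the named proposition `CleanLimitsHaveWindowsWithoutIsGroundState` and the
  conventional `cleanLimitsHaveWindows_false_without_isGroundState` live in the definition file
  `FalseWithoutGroundState.lean`), is FALSE — witness: the 2-adic ruler stacking (files 1–3:
  `clean`, `exists_ruler`, `exists_clusters`, `localLimit_of_clusters`, lemmas L1–L6).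

Reading for the provers: hypotheses H2–H5 of the crux (scale, origin, local limit, cleanness) are
jointly satisfiable by an aperiodic exact Barlow stacking which is its own local limit and has no
periodic windows; everything the crux asserts beyond `CleanLocalLimit` must therefore come from the
energy (strain exactification + stacking selection, steps (b)–(c) of the card), and a proof that only
uses the SHAPES of the shells cannot exist.  Nothing here closes an item; no theorem concludes a Theses
decl.  All `[folklore]`.
-/

noncomputable section

namespace Summit.AtomisticToContinuum.Crystallization.Theorems.CleanLimitsHaveWindows.Negative

open Literature.MathematicalPhysics.StatisticalMechanics Literature.Geometry.DiscreteGeometry Filter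

/-- **No periodic windows.** Let `s` be a Hägg sequence with no `m`-periodic stretch of `4m + 1`
comparisons (`exists_ruler`) and let `x N ⊆ Y = barlowStacking 1 √(2/3) s` be clusters containing
every point of `Y` of norm `≤ ρ N − 1` and contained in norm `≤ ρ N` (`exists_clusters`). Then the
CONCLUSION of the crux fails for `x`: no periodic configuration `P` is two-way `ε`-matched with
translates of `x N` on `B(0, R)` at every scale. Proof (fix `P`, `ε = 1/10`, one large `R`, one
matched `(N, t)`): (ii) relative density of `P.points` (L1) puts the window `B(−t, R/2)` inside the
cluster; (iii) the lattice vector `g₀` with `g₀ ₃ ≠ 0` and the first-exit argument (L6) on its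
multiples (all `0.2`-almost-periods of the window, whose third coordinates live in `Hℤ`) give a
lattice vector `g` with `g₃ = M H ± 0.2`, `M ≥ 1`; (iv)–(v) every layer `k` of the window has a
point `p` and a point `p'` of layer `k + M` with `p' − p = g ± 0.2`; (vi) comparing two layers, the
lateral parts differ by a vector of `ℤu + ℤv + ℤw` of norm `≤ 0.4`, so (L5) the letter shifts
`L(k+M) − L(k)` agree mod `3`, whence `s (k + M) = s k` on `4M + 1` consecutive layers of the
window — contradicting the choice of `s`. [folklore] -/
theorem no_windows {s : ℤ → ℤ} (hs : IsHaggSeq s)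
    (haper : ∀ m : ℤ, 0 < m → ∀ k₁ : ℤ, ∃ k, k₁ ≤ k ∧ k ≤ k₁ + 4 * m ∧ s (k + m) ≠ s k)
    {x : (N : ℕ) → (Fin N → (EuclideanSpace ℝ (Fin 3)))} {ρ : ℕ → ℕ}
    (hxY : ∀ N i, x N i ∈ barlowStacking 1 (Real.sqrt (2 / 3)) s ∧ ‖x N i‖ ≤ ρ N)
    (hfill : ∀ N, ∀ p ∈ barlowStacking 1 (Real.sqrt (2 / 3)) s, ‖p‖ ≤ ρ N - 1 → ∃ i : Fin N, x N i = p) :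
    ¬ ∃ P : PeriodicConfiguration 3, ∀ R ε : ℝ, 0 < ε → ∃ᶠ N in atTop, ∃ t : (EuclideanSpace ℝ (Fin 3)),
      (∀ q ∈ P.points, ‖q‖ ≤ R → ∃ i : Fin N, dist (x N i + t) q ≤ ε) ∧
      (∀ i : Fin N, ‖x N i + t‖ ≤ R → ∃ q ∈ P.points, dist (x N i + t) q ≤ ε) := by
  rintro ⟨P, hP⟩
  have hH : (0.81 : ℝ) < Real.sqrt (2 / 3) ∧ Real.sqrt (2 / 3) < 0.82 :=
    ⟨by rw [Real.lt_sqrt (by norm_num)]; norm_num, by rw [Real.sqrt_lt' (by norm_num)]; norm_num⟩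
  have H_pos : (0 : ℝ) < Real.sqrt (2 / 3) := Real.sqrt_pos.2 (by norm_num)
  have abs_apply_le_norm : ∀ (v : EuclideanSpace ℝ (Fin 3)) (l : Fin 3), |v l| ≤ ‖v‖ :=
    fun v l => by simpa using PiLp.norm_apply_le v l
  -- data of `P`
  obtain ⟨y₀, hy₀⟩ := P.motif_nonempty
  have hy₀P : y₀ ∈ P.points := P.mem_points_of_mem_motif hy₀
  obtain ⟨D, hD0, hdense⟩ := dense_points P
  obtain ⟨g₀, hg₀, hγ0⟩ := P.exists_mem_lattice_apply_two_ne_zero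
  obtain ⟨γ, hγdef⟩ : ∃ γ : ℝ, γ = g₀ 2 := ⟨_, rfl⟩
  have hγ : γ ≠ 0 := hγdef ▸ hγ0
  have hg₀ne : g₀ ≠ 0 := by
    rintro rfl
    exact hγ0 rfl
  have hγpos : 0 < |γ| := abs_pos.2 hγ
  obtain ⟨n₀, hn₀⟩ : ∃ n₀ : ℕ, 1 ≤ n₀ * |γ| := by
    refine ⟨⌈1 / |γ|⌉₊, ?_⟩
    have := Nat.le_ceil (1 / |γ|)
    rwa [div_le_iff₀ hγpos] at this
  have hγle : |γ| ≤ ‖g₀‖ := hγdef ▸ abs_apply_le_norm g₀ 2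
  have hg₀nn : 0 ≤ ‖g₀‖ := norm_nonneg g₀
  have hy₀nn : 0 ≤ ‖y₀‖ := norm_nonneg y₀
  have hn₀nn : (0 : ℝ) ≤ n₀ := Nat.cast_nonneg n₀
  -- the scale of the window
  obtain ⟨R, hR⟩ : ∃ R : ℝ, R = ‖y₀‖ + 40 * (n₀ + 1) * ‖g₀‖ + 10 * D + 100 := ⟨_, rfl⟩
  have hR1 : ‖y₀‖ + n₀ * ‖g₀‖ ≤ R := by rw [hR]; nlinarith
  have hR2 : 4 * ‖g₀‖ + 4 * D + 10 ≤ R := by rw [hR]; nlinarith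
  obtain ⟨N, t, hM1, hM2⟩ := (hP R (1 / 10) (by norm_num)).exists
  -- (F) facts about the cluster
  have hF1 : ∀ i : Fin N, x N i ∈ barlowStacking 1 (Real.sqrt (2 / 3)) s := fun i => (hxY N i).1
  have hF3 : ∀ i : Fin N, ‖x N i‖ ≤ ρ N := fun i => (hxY N i).2
  -- (ii) the translate bound: the window sits inside the cluster
  have ht : ‖t‖ ≤ ρ N - R + 2 * D + 1 / 10 := by
    obtain ⟨z, hz, hzt⟩ := exists_far_point t (ρ := R - D) (by linarith) hg₀ne
    obtain ⟨q, hq, hzq⟩ := hdense z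
    have hqR : ‖q‖ ≤ R := by
      have : ‖q‖ ≤ ‖z‖ + ‖q - z‖ := by
        have := norm_add_le z (q - z); rwa [add_sub_cancel] at this
      rw [← dist_eq_norm, dist_comm] at this
      linarith
    obtain ⟨i, hi⟩ := hM1 q hq hqR
    have h1 : dist z (x N i + t) ≤ D + 1 / 10 :=
      (dist_triangle z q _).trans (by rw [dist_comm q]; linarith)
    have h2 : ‖z - t‖ ≤ ‖x N i‖ + dist z (x N i + t) := by
      have e : z - t = x N i + (z - (x N i + t)) := by abel
      rw [e, dist_eq_norm]
      exact norm_add_le _ _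
    linarith [hF3 i]
  -- (iii) a transverse lattice vector
  have hmult : ∀ k : ℕ, k ≤ n₀ → ∃ n : ℤ, |k * γ - n * (Real.sqrt (2 / 3))| ≤ 0.2 := by
    intro k hk
    have hmem : y₀ + (k : ℝ) • g₀ ∈ P.points := by
      rw [Nat.cast_smul_eq_nsmul ℝ]; exact P.add_mem_points hy₀P (nsmul_mem hg₀ k)
    have hnorm : ‖y₀ + (k : ℝ) • g₀‖ ≤ R := by
      have hk' : (k : ℝ) ≤ n₀ := by exact_mod_cast hk
      calc ‖y₀ + (k : ℝ) • g₀‖ ≤ ‖y₀‖ + ‖(k : ℝ) • g₀‖ := norm_add_le _ _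
        _ = ‖y₀‖ + k * ‖g₀‖ := by rw [norm_smul, Real.norm_natCast]
        _ ≤ R := by nlinarith
    obtain ⟨i₀, hi₀⟩ := hM1 y₀ hy₀P (by linarith [hR1, mul_nonneg hn₀nn hg₀nn])
    obtain ⟨i₁, hi₁⟩ := hM1 _ hmem hnorm
    obtain ⟨a, ha⟩ := apply_two_of_mem (hF1 i₀)
    obtain ⟨b, hb⟩ := apply_two_of_mem (hF1 i₁)
    refine ⟨b - a, ?_⟩
    have hdiff : ‖(x N i₁ + t - (y₀ + (k : ℝ) • g₀)) - (x N i₀ + t - y₀)‖ ≤ 2 / 10 := by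
      refine (norm_sub_le _ _).trans ?_
      rw [← dist_eq_norm, ← dist_eq_norm]
      linarith
    have hcoord := abs_apply_le_norm ((x N i₁ + t - (y₀ + (k : ℝ) • g₀)) - (x N i₀ + t - y₀)) 2
    have e : ((x N i₁ + t - (y₀ + (k : ℝ) • g₀)) - (x N i₀ + t - y₀)) 2 =
        -(k * γ - ((b - a : ℤ) : ℝ) * (Real.sqrt (2 / 3))) := by
      rw [hγdef]
      simp only [PiLp.sub_apply, PiLp.add_apply, PiLp.smul_apply, smul_eq_mul, ha, hb]
      push_cast
      ring
    rw [e, abs_neg] at hcoord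
    linarith
  obtain ⟨n, hn0, hn⟩ := exists_transverse hn₀ hmult
  obtain ⟨g, M, hgL, hgnorm, hMpos, hgM⟩ :
      ∃ (g : (EuclideanSpace ℝ (Fin 3))) (M : ℤ), g ∈ P.lattice ∧ ‖g‖ = ‖g₀‖ ∧ 1 ≤ M ∧ |g 2 - M * (Real.sqrt (2 / 3))| ≤ 0.2 := by
    rcases lt_or_gt_of_ne hn0 with hneg | hpos
    · refine ⟨-g₀, -n, P.lattice.neg_mem hg₀, norm_neg _, by omega, ?_⟩
      have e : (-g₀) 2 - ((-n : ℤ) : ℝ) * (Real.sqrt (2 / 3)) = -(γ - n * (Real.sqrt (2 / 3))) := by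
        rw [PiLp.neg_apply, hγdef]; push_cast; ring
      rw [e, abs_neg]; exact hn
    · exact ⟨g₀, n, hg₀, rfl, hpos, by rw [← hγdef]; exact hn⟩
  have hMH : (M : ℝ) * (Real.sqrt (2 / 3)) ≤ ‖g₀‖ + 0.2 := by
    have h1 : |g 2| ≤ ‖g₀‖ := hgnorm ▸ abs_apply_le_norm g 2
    have h2 := (abs_le.1 hgM).1
    have h3 := (abs_le.1 h1).2
    linarith
  have hMone : (1 : ℝ) ≤ M := by exact_mod_cast hMpos
  -- (iv) every admissible layer carries an almost-period `g`
  have hlayer : ∀ k : ℤ, |(k : ℝ) * (Real.sqrt (2 / 3)) + t 2| ≤ R / 2 - 1 →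
      ∃ i j k' i' j' : ℤ,
        ‖barlowPos 1 (Real.sqrt (2 / 3)) s k' i' j' - barlowPos 1 (Real.sqrt (2 / 3)) s k i j - g‖ ≤ 2 / 10 := by
    intro k hk
    obtain ⟨i, j, hij⟩ := exists_layer_point_near s (-t) k
    set p := barlowPos 1 (Real.sqrt (2 / 3)) s k i j with hp
    have hpt : ‖p + t‖ ≤ R / 2 := by
      have e : dist p (-t) = ‖p + t‖ := by rw [dist_eq_norm, sub_neg_eq_add]
      have hk' : ((k : ℝ) * (Real.sqrt (2 / 3)) - (-t) 2) ^ 2 ≤ (R / 2 - 1) ^ 2 := by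
        rw [PiLp.neg_apply, sub_neg_eq_add]
        exact sq_le_sq' (by linarith [(abs_le.1 hk).1]) (abs_le.1 hk).2
      have h1 : dist p (-t) ^ 2 ≤ (R / 2) ^ 2 := by nlinarith
      rw [← e]
      exact (pow_le_pow_iff_left₀ dist_nonneg (by linarith) two_ne_zero).1 h1
    have hpmem : p ∈ barlowStacking 1 (Real.sqrt (2 / 3)) s := barlowPos_mem _ _ _
    have hpnorm : ‖p‖ ≤ ρ N - 1 := by
      have : ‖p‖ ≤ ‖p + t‖ + ‖t‖ := by
        have := norm_sub_le (p + t) t; rwa [add_sub_cancel_right] at this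
      linarith
    obtain ⟨i₁, hi₁⟩ : ∃ i₁ : Fin N, x N i₁ = p := hfill N p hpmem hpnorm
    obtain ⟨q₁, hq₁, hpq₁⟩ := hM2 i₁ (by rw [hi₁]; linarith)
    rw [hi₁] at hpq₁
    have hq₁g : q₁ + g ∈ P.points := P.add_mem_points hq₁ hgL
    have hq₁gn : ‖q₁ + g‖ ≤ R := by
      have h1 : ‖q₁‖ ≤ ‖p + t‖ + ‖q₁ - (p + t)‖ := by
        have := norm_add_le (p + t) (q₁ - (p + t)); rwa [add_sub_cancel] at this
      rw [← dist_eq_norm, dist_comm] at h1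
      calc ‖q₁ + g‖ ≤ ‖q₁‖ + ‖g‖ := norm_add_le _ _
        _ ≤ R := by rw [hgnorm]; linarith
    obtain ⟨i₂, hi₂⟩ := hM1 _ hq₁g hq₁gn
    obtain ⟨k', i', j', hk'⟩ := hF1 i₂
    refine ⟨i, j, k', i', j', ?_⟩
    have e : barlowPos 1 (Real.sqrt (2 / 3)) s k' i' j' - p - g = ((x N i₂ + t) - (q₁ + g)) + (q₁ - (p + t)) := by
      rw [← hk']; abel
    rw [e]
    calc ‖((x N i₂ + t) - (q₁ + g)) + (q₁ - (p + t))‖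
          ≤ ‖(x N i₂ + t) - (q₁ + g)‖ + ‖q₁ - (p + t)‖ := norm_add_le _ _
      _ ≤ 1 / 10 + 1 / 10 := by
          gcongr
          · rw [← dist_eq_norm]; exact hi₂
          · rw [← dist_eq_norm, dist_comm]; exact hpq₁
      _ = 2 / 10 := by norm_num
  -- (v) the almost-period shifts layers by exactly `M`
  have hshift : ∀ {k i j k' i' j' : ℤ},
      ‖barlowPos 1 (Real.sqrt (2 / 3)) s k' i' j' - barlowPos 1 (Real.sqrt (2 / 3)) s k i j - g‖ ≤ 2 / 10 →
        k' = k + M := by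
    intro k i j k' i' j' h
    have hc := abs_apply_le_norm (barlowPos 1 (Real.sqrt (2 / 3)) s k' i' j' - barlowPos 1 (Real.sqrt (2 / 3)) s k i j - g) 2
    simp only [PiLp.sub_apply, barlowPos_apply_two] at hc
    have h1 : |((k' - k - M : ℤ) : ℝ) * (Real.sqrt (2 / 3))| ≤ 0.4 := by
      have e : ((k' - k - M : ℤ) : ℝ) * (Real.sqrt (2 / 3)) = ((k' : ℝ) * (Real.sqrt (2 / 3)) - k * (Real.sqrt (2 / 3)) - g 2) + (g 2 - M * (Real.sqrt (2 / 3))) := by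
        push_cast; ring
      rw [e]
      exact (abs_add_le _ _).trans (by linarith)
    have h2 : |((k' - k - M : ℤ) : ℝ)| < 1 := by
      rw [abs_mul, abs_of_pos H_pos] at h1
      by_contra hcon
      push Not at hcon
      nlinarith [hH.1]
    have h3 : |k' - k - M| < 1 := by
      have : (((|k' - k - M| : ℤ) : ℝ)) < 1 := by rw [Int.cast_abs]; exact h2
      exact_mod_cast this
    have := Int.abs_lt_one_iff.1 h3
    omega
  -- (vi) two admissible layers have the same letter shift modulo `3`
  have hcong : ∀ {k i j i' j' l m n m' n' : ℤ},
      ‖barlowPos 1 (Real.sqrt (2 / 3)) s (k + M) i' j' - barlowPos 1 (Real.sqrt (2 / 3)) s k i j - g‖ ≤ 2 / 10 →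
      ‖barlowPos 1 (Real.sqrt (2 / 3)) s (l + M) m' n' - barlowPos 1 (Real.sqrt (2 / 3)) s l m n - g‖ ≤ 2 / 10 →
        (3 : ℤ) ∣ (haggLabel s (k + M) - haggLabel s k) -
          (haggLabel s (l + M) - haggLabel s l) := by
    intro k i j i' j' l m n m' n' h1 h2
    set v1 := barlowPos 1 (Real.sqrt (2 / 3)) s (k + M) i' j' - barlowPos 1 (Real.sqrt (2 / 3)) s k i j with hv1
    set v2 := barlowPos 1 (Real.sqrt (2 / 3)) s (l + M) m' n' - barlowPos 1 (Real.sqrt (2 / 3)) s l m n with hv2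
    have hd : ‖v1 - v2‖ ≤ 0.4 := by
      have e : v1 - v2 = (v1 - g) - (v2 - g) := by abel
      rw [e]
      exact (norm_sub_le _ _).trans (by linarith)
    have hsq : ‖v1 - v2‖ ^ 2 ≤ 0.16 := by nlinarith [norm_nonneg (v1 - v2)]
    have key := norm_sq_dd s k i j (k + M) i' j' l m n (l + M) m' n'
    rw [← hv1, ← hv2] at key
    have hT3 : ((((k + M - k) - (l + M - l) : ℤ) : ℝ) * (Real.sqrt (2 / 3))) ^ 2 = 0 := by push_cast; ring
    refine three_dvd_of_lateral_small (A := (i' - i) - (m' - m)) (B := (j' - j) - (n' - n)) ?_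
    linarith [hsq, key, hT3]
  -- (vii) hence the ruler word would be `M`-periodic on `4M + 1` consecutive layers
  obtain ⟨k₁, hk₁a, hk₁b⟩ : ∃ k₁ : ℤ, (-t 2 - (R / 2 - 1)) / (Real.sqrt (2 / 3)) ≤ k₁ ∧
      (k₁ : ℝ) < (-t 2 - (R / 2 - 1)) / (Real.sqrt (2 / 3)) + 1 :=
    ⟨⌈(-t 2 - (R / 2 - 1)) / (Real.sqrt (2 / 3))⌉, Int.le_ceil _, Int.ceil_lt_add_one _⟩
  have hK : ∀ k : ℤ, k₁ ≤ k → k ≤ k₁ + 4 * M + 1 → |(k : ℝ) * (Real.sqrt (2 / 3)) + t 2| ≤ R / 2 - 1 := by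
    intro k hk1 hk2
    have h1 := hk₁a
    have h2 := hk₁b
    rw [div_le_iff₀ H_pos] at h1
    rw [← sub_lt_iff_lt_add, lt_div_iff₀ H_pos] at h2
    have hk1' : (k₁ : ℝ) ≤ k := by exact_mod_cast hk1
    have hk2' : (k : ℝ) ≤ k₁ + 4 * M + 1 := by exact_mod_cast hk2
    have hHp := H_pos
    have hlo : (k₁ : ℝ) * (Real.sqrt (2 / 3)) ≤ k * (Real.sqrt (2 / 3)) := mul_le_mul_of_nonneg_right hk1' hHp.le
    have hhi : (k : ℝ) * (Real.sqrt (2 / 3)) ≤ (k₁ + 4 * M + 1) * (Real.sqrt (2 / 3)) := mul_le_mul_of_nonneg_right hk2' hHp.le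
    rw [abs_le]
    constructor
    · linarith
    · linarith [hH.2]
  have hper : ∀ k : ℤ, k₁ ≤ k → k ≤ k₁ + 4 * M → s (k + M) = s k := by
    intro k hk1 hk2
    obtain ⟨i, j, k', i', j', h1⟩ := hlayer k (hK k hk1 (hk2.trans (le_add_of_nonneg_right zero_le_one)))
    obtain ⟨m, n, l', m', n', h2⟩ :=
      hlayer (k + 1) (hK (k + 1) (hk1.trans (le_add_of_nonneg_right zero_le_one)) (by linarith only [hk2]))
    have e1 : k' = k + M := hshift h1
    have e2 : l' = k + 1 + M := hshift h2
    subst e1 e2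
    have h3 := hcong h1 h2
    rw [show k + 1 + M = k + M + 1 by ring, haggLabel_succ, haggLabel_succ] at h3
    have h3' : (3 : ℤ) ∣ s k - s (k + M) := by
      have e : haggLabel s (k + M) - haggLabel s k -
          (haggLabel s (k + M) + s (k + M) - (haggLabel s k + s k)) =
          s k - s (k + M) := by ring
      rwa [e] at h3
    rcases hs (k + M) with ha | ha <;> rcases hs k with hb | hb <;> rw [ha, hb] at h3' ⊢ <;>
      first | rfl | (exfalso; omega)
  obtain ⟨k, hk1, hk2, hne⟩ := haper M (zero_lt_one.trans_le hMpos) k₁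
  exact hne (hper k hk1 hk2)

/-- **`CleanLimitsHaveWindows` is FALSE without `IsGroundState`** (load-bearing analysis of the
crux, hypothesis H1; statement inline): the crux
`GappedShellCensus.CleanLimitsHaveWindows` (stmt-AtomisticToContinuum-15932) with
`∀ N, IsGroundState lennardJones (x N)` weakened to `∀ N, Function.Injective (x N)`, everything
else verbatim — fails. Witness: `Y` = the unit ideal stacking of the ruler word (`exists_ruler`),
`a = 1`, `x` = its cluster sequence (`exists_clusters`): `0 ∈ Y`, `Y` is a local limit of `x`
(`localLimit_of_clusters`, H4), every site of `Y` is gapped-twelve with an exactly fcc/hcp shell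
(`clean`, H5), and `x` has no periodic windows (`no_windows`). CONSEQUENCE: any proof of the crux
must use ground-state energetics to exclude aperiodically stacked (and, more generally, non-periodic
clean) local limits — geometry (H2–H5) alone does not give the conclusion. [folklore] -/
theorem not_cleanLimitsHaveWindows_without_isGroundState :
    ¬ (∀ x : (N : ℕ) → (Fin N → EuclideanSpace ℝ (Fin 3)), (∀ N, Function.Injective (x N)) →
        ∀ (Y : Set (EuclideanSpace ℝ (Fin 3))) (a : ℝ), 47 / 50 ≤ a → a ≤ 1 →
          (0 : EuclideanSpace ℝ (Fin 3)) ∈ Y →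
          (∃ (φ : ℕ → ℕ) (t : ℕ → EuclideanSpace ℝ (Fin 3)), StrictMono φ ∧ ∀ R ε : ℝ, 0 < ε →
            ∀ᶠ n in Filter.atTop, (∀ y ∈ Y, ‖y‖ ≤ R → ∃ i : Fin (φ n), dist (x (φ n) i + t n) y ≤ ε) ∧
              (∀ i : Fin (φ n), ‖x (φ n) i + t n‖ ≤ R → ∃ y ∈ Y, dist (x (φ n) i + t n) y ≤ ε)) →
          (∀ y ∈ Y, ({w ∈ Y | w ≠ y ∧ dist y w ≤ a * (1 + 1 / 50)}.ncard = 12 ∧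
              ∀ w ∈ Y, w ≠ y → a * (1 - 1 / 50) ≤ dist y w ∧
                (dist y w ≤ a * (1 + 1 / 50) ∨ a * (63 / 50) ≤ dist y w)) ∧
            ∃ T : Finset (EuclideanSpace ℝ (Fin 3)),
              (↑T : Set (EuclideanSpace ℝ (Fin 3))) =
                  (fun w => a⁻¹ • (w - y)) '' {w ∈ Y | w ≠ y ∧ dist y w ≤ a * (1 + 1 / 50)} ∧
                (Literature.Geometry.DiscreteGeometry.ShellCloseTo (1 / 5) T
                    Literature.Geometry.DiscreteGeometry.fccKissingPattern ∨
                  Literature.Geometry.DiscreteGeometry.ShellCloseTo (1 / 5) T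
                    Literature.Geometry.DiscreteGeometry.hcpKissingPattern)) →
          ∃ P : Literature.MathematicalPhysics.StatisticalMechanics.PeriodicConfiguration 3,
            ∀ R ε : ℝ, 0 < ε → ∃ᶠ N in Filter.atTop, ∃ t : EuclideanSpace ℝ (Fin 3),
              (∀ s ∈ P.points, ‖s‖ ≤ R → ∃ i : Fin N, dist (x N i + t) s ≤ ε) ∧
                (∀ i : Fin N, ‖x N i + t‖ ≤ R → ∃ s ∈ P.points, dist (x N i + t) s ≤ ε)) := by
  intro h
  obtain ⟨r, hr, haper⟩ := exists_ruler
  obtain ⟨x, ρ, hinj, hxY, hfill, hρ⟩ := exists_clusters hr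
  have h0 : (0 : (EuclideanSpace ℝ (Fin 3))) ∈ barlowStacking 1 (Real.sqrt (2 / 3)) r := ⟨0, 0, 0, by simp [barlowPos]⟩
  exact no_windows hr haper hxY hfill (h x hinj _ 1 (by norm_num) le_rfl h0
    (localLimit_of_clusters (fun N i => (hxY N i).1) hfill hρ) (clean hr))

end Summit.AtomisticToContinuum.Crystallization.Theorems.CleanLimitsHaveWindows.Negative

end
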